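import Summits.SmoothPoincare4.SmoothPoincare4.Theorems.CylinderEntropyCylinderRungTwoSmallCapAsymptotics
import Summits.SmoothPoincare4.SmoothPoincare4.Theorems.CylinderEntropyCylinderRungTwoProductIdentification
import Summits.SmoothPoincare4.SmoothPoincare4.Theorems.CylinderEntropySliceIsolationConformalMapLipschitz
import Mathlib.MeasureTheory.Integral.Lebesgue.DominatedConvergence
import HarnessLib

/-!
# Route `CylinderEntropy`, crux `CylinderRungTwo` (stmt-SmoothPoincare4-7631), line `killing-flux`:
# the `4`-density of a product measure `(uniform on S⁴) ⊗ σ` on `N = S⁴ × ℝ ⊂ ℝ⁶`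
# (registered helper `helper_densityOfProductMeasure`, step S7b of the area-quantization plan)

Let `μ` be a finite Borel measure on `ℝ⁶` whose push-forward under `π z = (z', z₅)`
(`z' = truncL z ∈ ℝ⁵` the first five coordinates) is the product `U ⊗ σ` of the normalised surface
measure `U = μH⁴(S⁴)⁻¹ · μH⁴⌊S⁴` of the unit sphere `S⁴ ⊂ ℝ⁵` with the height marginal
`σ = (z ↦ z₅)_* μ`.  Then at every point `x` of the cylinder `N = S⁴ × ℝ` the `4`-density of `μ`
(against flat `4`-discs) exists and equals the `σ`-mass of the height `x₅`, normalised: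

  `μ (B(x, r)) / μH⁴ (B⁴(0, r)) → μ {z | z₅ = x₅} / μH⁴(S⁴)`  as `r → 0⁺`.

Proof (dominated convergence over heights).
* `‖z - x‖² = ‖z' - x'‖² + (z₅ - x₅)²`, so `B(x, r) = π⁻¹ D_r` with the open "slab ball"
  `D_r = {(v, s) | ‖v - x'‖² + (s - x₅)² < r²} ⊆ ℝ⁵ × ℝ`; hence
  `μ (B(x, r)) = (U ⊗ σ)(D_r) = ∫ U(D_r^s) dσ(s)` (Tonelli), the section `D_r^s` being the ball
  `B(x', √(r² - (s - x₅)²)) ⊆ B(x', r)` (empty once `r ≤ |s - x₅|`, all of `B(x', r)` at `s = x₅`).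
* Divide by `b(r) = μH⁴(B⁴(0, r)) ∈ (0, ∞)`.  Pointwise in `s`, `U(D_r^s) / b(r)` tends to
  `μH⁴(S⁴)⁻¹ · 𝟙{s = x₅}`: at `s = x₅` this is the small-cap asymptotics
  `μH⁴(S⁴ ∩ B(x', r)) / b(r) → 1` (`helper_smallCapAsymptotics`, first item), and for `s ≠ x₅`
  the section is eventually empty.
* Domination: `U(D_r^s) / b(r) ≤ μH⁴(S⁴)⁻¹ · μH⁴(S⁴ ∩ B(x', r)) / b(r) ≤ μH⁴(S⁴)⁻¹ · C` with the
  uniform constant of `helper_smallCapAsymptotics` (second item); constants are `σ`-integrable,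
  `σ` being finite.
* The limit integral is `μH⁴(S⁴)⁻¹ · σ{x₅} = μ {z₅ = x₅} / μH⁴(S⁴)`.

Everything here is PROVED (no `sorry`, no new definitions, no named facts); the carrier
hypothesis `μ(ℝ⁶ ∖ N) = 0` of the registered signature is not used.

References: H. Federer, *Geometric measure theory* (1969), 2.10.45 (product measures), 3.2.19
(densities); P. Mattila, *Geometry of sets and measures in Euclidean spaces* (1995), Chapter 6
(density theorems).
-/

-- the prescribed namespace `Summit.SmoothPoincare4.SmoothPoincare4.…` repeats `SmoothPoincare4`
set_option linter.dupNamespace false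

noncomputable section

open MeasureTheory Set Filter
open scoped ENNReal NNReal Topology BigOperators

namespace Summit.SmoothPoincare4.SmoothPoincare4.Cruxes.CylinderRungTwo.KillingFlux

open Literature.Geometry.Riemannian.SphericalCylinderEntropy (truncL truncL_apply
  hausdorffMeasure_sphere_four_pos hausdorffMeasure_sphere_four_lt_top)
open Summit.SmoothPoincare4.SmoothPoincare4.Theorems.CylinderEntropySliceIsolation
  (norm_sub_sq_eq_norm_truncL_sub_sq_add)

/-! ## Coordinates: balls of `ℝ⁶` are slab balls of `ℝ⁵ × ℝ` -/

/-- **Balls of `ℝ⁶` are preimages of slab balls**: for `0 < r`,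
`B(x, r) = π⁻¹ {(v, s) | ‖v - x'‖² + (s - x₅)² < r²}` with `π z = (z', z₅)`
(`‖z - x‖² = ‖z' - x'‖² + (z₅ - x₅)²`, the tree's `norm_sub_sq_eq_norm_truncL_sub_sq_add`).
[folklore] -/
theorem ball_eq_preimage_slab (x : EuclideanSpace ℝ (Fin 6)) {r : ℝ} (hr : 0 < r) :
    Metric.ball x r = (fun z : EuclideanSpace ℝ (Fin 6) => (truncL z, z 5)) ⁻¹'
      {p : EuclideanSpace ℝ (Fin 5) × ℝ | ‖p.1 - truncL x‖ ^ 2 + (p.2 - x 5) ^ 2 < r ^ 2} := by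
  ext z
  rw [Metric.mem_ball, dist_eq_norm, Set.mem_preimage, Set.mem_setOf_eq,
    ← norm_sub_sq_eq_norm_truncL_sub_sq_add, sq_lt_sq₀ (norm_nonneg _) hr.le]

/-- The slab ball `{(v, s) | ‖v - a‖² + (s - c)² < r²} ⊆ ℝ⁵ × ℝ` is measurable (it is open).
[folklore] -/
theorem measurableSet_slab (a : EuclideanSpace ℝ (Fin 5)) (c r : ℝ) :
    MeasurableSet {p : EuclideanSpace ℝ (Fin 5) × ℝ | ‖p.1 - a‖ ^ 2 + (p.2 - c) ^ 2 < r ^ 2} := by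
  have hc : Continuous fun p : EuclideanSpace ℝ (Fin 5) × ℝ => ‖p.1 - a‖ ^ 2 + (p.2 - c) ^ 2 := by
    fun_prop
  exact (isOpen_lt hc continuous_const).measurableSet

/-- Every height section of the slab ball of radius `r > 0` lies in the ball `B(a, r)` of `ℝ⁵`.
[folklore] -/
theorem section_slab_subset_ball (a : EuclideanSpace ℝ (Fin 5)) (c s : ℝ) {r : ℝ} (hr : 0 < r) :
    (fun v : EuclideanSpace ℝ (Fin 5) => (v, s)) ⁻¹'
        {p : EuclideanSpace ℝ (Fin 5) × ℝ | ‖p.1 - a‖ ^ 2 + (p.2 - c) ^ 2 < r ^ 2} ⊆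
      Metric.ball a r := by
  intro v hv
  rw [Set.mem_preimage, Set.mem_setOf_eq] at hv
  rw [Metric.mem_ball, dist_eq_norm, ← sq_lt_sq₀ (norm_nonneg _) hr.le]
  nlinarith [sq_nonneg (s - c)]

/-- The height-`c` section of the slab ball centred at height `c` is the whole ball `B(a, r)`.
[folklore] -/
theorem section_slab_self (a : EuclideanSpace ℝ (Fin 5)) (c : ℝ) {r : ℝ} (hr : 0 < r) :
    (fun v : EuclideanSpace ℝ (Fin 5) => (v, c)) ⁻¹'
        {p : EuclideanSpace ℝ (Fin 5) × ℝ | ‖p.1 - a‖ ^ 2 + (p.2 - c) ^ 2 < r ^ 2} =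
      Metric.ball a r := by
  ext v
  rw [Set.mem_preimage, Set.mem_setOf_eq, sub_self, zero_pow two_ne_zero, add_zero,
    Metric.mem_ball, dist_eq_norm, sq_lt_sq₀ (norm_nonneg _) hr.le]

/-- The sections of the slab ball of radius `r > 0` at heights `s` with `r ≤ |s - c|` are empty.
[folklore] -/
theorem section_slab_eq_empty (a : EuclideanSpace ℝ (Fin 5)) (c s : ℝ) {r : ℝ} (hr : 0 < r)
    (h : r ≤ |s - c|) :
    (fun v : EuclideanSpace ℝ (Fin 5) => (v, s)) ⁻¹'
        {p : EuclideanSpace ℝ (Fin 5) × ℝ | ‖p.1 - a‖ ^ 2 + (p.2 - c) ^ 2 < r ^ 2} = ∅ := by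
  ext v
  rw [Set.mem_preimage, Set.mem_setOf_eq, Set.mem_empty_iff_false, iff_false, not_lt]
  have h2 : r ^ 2 ≤ (s - c) ^ 2 := by
    rw [← sq_abs (s - c)]
    exact pow_le_pow_left₀ hr.le h 2
  nlinarith [sq_nonneg ‖v - a‖]

/-! ## Dominated convergence over heights -/

/-- Flat `d`-discs `B^d(0, r)`, `r > 0`, have non-zero `μH[d]`-measure (`μH[d]` is an additive Haar
measure on `EuclideanSpace ℝ (Fin d)`). [folklore] -/
theorem hausdorffMeasure_ball_fin_ne_zero (d : ℕ) {r : ℝ} (hr : 0 < r) :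
    μH[d] (Metric.ball (0 : EuclideanSpace ℝ (Fin d)) r) ≠ 0 :=
  (Metric.measure_ball_pos _ _ hr).ne'

/-- Flat `d`-discs `B^d(0, r)` have finite `μH[d]`-measure (`μH[d]` is an additive Haar measure on
`EuclideanSpace ℝ (Fin d)`). [folklore] -/
theorem hausdorffMeasure_ball_fin_ne_top (d : ℕ) (r : ℝ) :
    μH[d] (Metric.ball (0 : EuclideanSpace ℝ (Fin d)) r) ≠ ⊤ :=
  measure_ball_lt_top.ne

/-- **The height integral of the normalised sections converges.** For `a ∈ S⁴`, a height `c` and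
a finite measure `σ` on `ℝ`, with `U = μH⁴(S⁴)⁻¹ · μH⁴⌊S⁴` and `D_r` the slab ball of radius `r`
centred at `(a, c)`:
`∫ U(D_r^s) / μH⁴(B⁴(0, r)) dσ(s) → μH⁴(S⁴)⁻¹ · σ{c}` as `r → 0⁺` — dominated convergence, the
integrand tending to `μH⁴(S⁴)⁻¹ 𝟙{s = c}` (small-cap asymptotics at `s = c`, empty sections
eventually for `s ≠ c`) and being bounded by `μH⁴(S⁴)⁻¹ C` (uniform cap domination). [folklore] -/
theorem tendsto_lintegral_uniformSphere_section_slab (σ : Measure ℝ) [IsFiniteMeasure σ]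
    {a : EuclideanSpace ℝ (Fin 5)} (ha : ∑ i, a i ^ 2 = 1) (c : ℝ) :
    Tendsto (fun r : ℝ => ∫⁻ s,
        ((μH[4] (Metric.sphere (0 : EuclideanSpace ℝ (Fin 5)) 1))⁻¹ •
          (μH[4] : Measure (EuclideanSpace ℝ (Fin 5))).restrict
            (Metric.sphere (0 : EuclideanSpace ℝ (Fin 5)) 1))
          ((fun v : EuclideanSpace ℝ (Fin 5) => (v, s)) ⁻¹'
            {p : EuclideanSpace ℝ (Fin 5) × ℝ | ‖p.1 - a‖ ^ 2 + (p.2 - c) ^ 2 < r ^ 2}) *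
        (μH[4] (Metric.ball (0 : EuclideanSpace ℝ (Fin 4)) r))⁻¹ ∂σ)
      (𝓝[>] 0) (𝓝 ((μH[4] (Metric.sphere (0 : EuclideanSpace ℝ (Fin 5)) 1))⁻¹ * σ {c})) := by
  obtain ⟨hcap, C, hCt, hCle⟩ := helper_smallCapAsymptotics a ha
  have hV0 : μH[4] (Metric.sphere (0 : EuclideanSpace ℝ (Fin 5)) 1) ≠ 0 :=
    hausdorffMeasure_sphere_four_pos.ne'
  haveI := isFiniteMeasure_uniformSphere
  -- the normalised surface measure on measurable sets
  have hU : ∀ t : Set (EuclideanSpace ℝ (Fin 5)), MeasurableSet t →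
      ((μH[4] (Metric.sphere (0 : EuclideanSpace ℝ (Fin 5)) 1))⁻¹ •
          (μH[4] : Measure (EuclideanSpace ℝ (Fin 5))).restrict
            (Metric.sphere (0 : EuclideanSpace ℝ (Fin 5)) 1)) t =
        (μH[4] (Metric.sphere (0 : EuclideanSpace ℝ (Fin 5)) 1))⁻¹ *
          μH[4] (Metric.sphere (0 : EuclideanSpace ℝ (Fin 5)) 1 ∩ t) := by
    intro t ht
    rw [Measure.smul_apply, Measure.restrict_apply ht, smul_eq_mul, Set.inter_comm]
  have hb0 : ∀ r : ℝ, 0 < r → μH[4] (Metric.ball (0 : EuclideanSpace ℝ (Fin 4)) r) ≠ 0 :=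
    fun r hr => hausdorffMeasure_ball_fin_ne_zero 4 hr
  have hbt : ∀ r : ℝ, μH[4] (Metric.ball (0 : EuclideanSpace ℝ (Fin 4)) r) ≠ ⊤ :=
    fun r => hausdorffMeasure_ball_fin_ne_top 4 r
  rw [← lintegral_indicator_const (measurableSet_singleton c)]
  refine tendsto_lintegral_filter_of_dominated_convergence
    (fun _ => (μH[4] (Metric.sphere (0 : EuclideanSpace ℝ (Fin 5)) 1))⁻¹ * C)
    (Eventually.of_forall fun r =>
      (measurable_measure_prodMk_right (measurableSet_slab a c r)).mul_const _)
    ?_ ?_ (Eventually.of_forall fun s => ?_)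
  · -- domination by the constant `μH⁴(S⁴)⁻¹ C`
    filter_upwards [self_mem_nhdsWithin] with r hr
    refine Eventually.of_forall fun s => ?_
    calc ((μH[4] (Metric.sphere (0 : EuclideanSpace ℝ (Fin 5)) 1))⁻¹ •
            (μH[4] : Measure (EuclideanSpace ℝ (Fin 5))).restrict
              (Metric.sphere (0 : EuclideanSpace ℝ (Fin 5)) 1))
            ((fun v : EuclideanSpace ℝ (Fin 5) => (v, s)) ⁻¹'
              {p : EuclideanSpace ℝ (Fin 5) × ℝ | ‖p.1 - a‖ ^ 2 + (p.2 - c) ^ 2 < r ^ 2}) *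
          (μH[4] (Metric.ball (0 : EuclideanSpace ℝ (Fin 4)) r))⁻¹
        ≤ ((μH[4] (Metric.sphere (0 : EuclideanSpace ℝ (Fin 5)) 1))⁻¹ •
            (μH[4] : Measure (EuclideanSpace ℝ (Fin 5))).restrict
              (Metric.sphere (0 : EuclideanSpace ℝ (Fin 5)) 1)) (Metric.ball a r) *
          (μH[4] (Metric.ball (0 : EuclideanSpace ℝ (Fin 4)) r))⁻¹ := by
          gcongr
          exact section_slab_subset_ball a c s hr
      _ ≤ (μH[4] (Metric.sphere (0 : EuclideanSpace ℝ (Fin 5)) 1))⁻¹ *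
            (C * μH[4] (Metric.ball (0 : EuclideanSpace ℝ (Fin 4)) r)) *
          (μH[4] (Metric.ball (0 : EuclideanSpace ℝ (Fin 4)) r))⁻¹ := by
          rw [hU _ Metric.isOpen_ball.measurableSet]
          gcongr
          exact hCle r hr
      _ = (μH[4] (Metric.sphere (0 : EuclideanSpace ℝ (Fin 5)) 1))⁻¹ * C := by
          rw [mul_assoc, mul_assoc, ENNReal.mul_inv_cancel (hb0 r hr) (hbt r), mul_one]
  · -- the constant bound is integrable, `σ` being finite
    rw [lintegral_const]
    exact ENNReal.mul_ne_top (ENNReal.mul_ne_top (ENNReal.inv_ne_top.2 hV0) hCt.ne)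
      (measure_ne_top σ _)
  · -- pointwise limit
    by_cases hs : s = c
    · subst hs
      rw [Set.indicator_of_mem (Set.mem_singleton s)]
      have hlim := ENNReal.Tendsto.const_mul hcap
        (Or.inl one_ne_zero : (1 : ℝ≥0∞) ≠ 0 ∨
          (μH[4] (Metric.sphere (0 : EuclideanSpace ℝ (Fin 5)) 1))⁻¹ ≠ ⊤)
      rw [mul_one] at hlim
      refine hlim.congr' ?_
      filter_upwards [self_mem_nhdsWithin] with r hr
      rw [section_slab_self a s hr, hU _ Metric.isOpen_ball.measurableSet, mul_assoc,
        div_eq_mul_inv]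
    · rw [Set.indicator_of_notMem (fun h : s ∈ ({c} : Set ℝ) => hs (Set.mem_singleton_iff.1 h))]
      have hsc : 0 < |s - c| := abs_pos.2 (sub_ne_zero.2 hs)
      refine tendsto_const_nhds.congr' ?_
      filter_upwards [Ioc_mem_nhdsGT hsc] with r hr
      rw [section_slab_eq_empty a c s hr.1 hr.2, measure_empty, zero_mul]

/-! ## The registered helper -/

/-- **Registered helper `helper_densityOfProductMeasure` of line `killing-flux` (step S7b of the
area-quantization plan).** If a finite measure `μ` on `ℝ⁶` (carried by `N = S⁴ × ℝ`) pushes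
forward under `z ↦ (z', z₅)` to the product `(μH⁴(S⁴)⁻¹ · μH⁴⌊S⁴) ⊗ (z₅)_* μ` of the normalised
surface measure of `S⁴` with its height marginal, then at every `x ∈ N` its `4`-density against
flat `4`-discs is `μ (B(x, r)) / μH⁴(B⁴(0, r)) → μ {z₅ = x₅} / μH⁴(S⁴)` (`r → 0⁺`): balls are
slab balls in the coordinates `(z', z₅)`, Tonelli over heights, small-cap asymptotics of `S⁴` and
dominated convergence. [folklore] -/
theorem helper_densityOfProductMeasure : ∀ (μ : Measure (EuclideanSpace ℝ (Fin 6))) [IsFiniteMeasure μ], μ {z : EuclideanSpace ℝ (Fin 6) | ¬ (∑ i : Fin 5, z (Fin.castSucc i) ^ 2 = 1)} = 0 → Measure.map (fun z : EuclideanSpace ℝ (Fin 6) => (Literature.Geometry.Riemannian.SphericalCylinderEntropy.truncL z, z 5)) μ = ((μH[4] (Metric.sphere (0 : EuclideanSpace ℝ (Fin 5)) 1))⁻¹ • (μH[4] : Measure (EuclideanSpace ℝ (Fin 5))).restrict (Metric.sphere (0 : EuclideanSpace ℝ (Fin 5)) 1)).prod (Measure.map (fun z : EuclideanSpace ℝ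 (Fin 6) => z 5) μ) → ∀ x : EuclideanSpace ℝ (Fin 6), ∑ i : Fin 5, x (Fin.castSucc i) ^ 2 = 1 → Filter.Tendsto (fun r : ℝ => μ (Metric.ball x r) / μH[4] (Metric.ball (0 : EuclideanSpace ℝ (Fin 4)) r)) (𝓝[>] 0) (𝓝 (μ {z : EuclideanSpace ℝ (Fin 6) | z 5 = x 5} / μH[4] (Metric.sphere (0 : EuclideanSpace ℝ (Fin 5)) 1))) := by
  intro μ _ _ hprod x hx
  have h5 : Measurable fun z : EuclideanSpace ℝ (Fin 6) => z 5 :=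
    (by fun_prop : Continuous fun z : EuclideanSpace ℝ (Fin 6) => z 5).measurable
  have hπ : Measurable fun z : EuclideanSpace ℝ (Fin 6) => (truncL z, z 5) :=
    truncL.continuous.measurable.prodMk h5
  have ha : ∑ i : Fin 5, (truncL x) i ^ 2 = 1 := by
    simp only [truncL_apply]
    exact hx
  haveI := isFiniteMeasure_uniformSphere
  -- the limit value: `μH⁴(S⁴)⁻¹ · σ{x₅} = μ {z₅ = x₅} / μH⁴(S⁴)`
  have hval : (μH[4] (Metric.sphere (0 : EuclideanSpace ℝ (Fin 5)) 1))⁻¹ *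
      (Measure.map (fun z : EuclideanSpace ℝ (Fin 6) => z 5) μ) {x 5} =
        μ {z : EuclideanSpace ℝ (Fin 6) | z 5 = x 5} /
          μH[4] (Metric.sphere (0 : EuclideanSpace ℝ (Fin 5)) 1) := by
    rw [Measure.map_apply h5 (measurableSet_singleton _), div_eq_mul_inv, mul_comm]
    rfl
  rw [← hval]
  refine (tendsto_lintegral_uniformSphere_section_slab
    (Measure.map (fun z : EuclideanSpace ℝ (Fin 6) => z 5) μ) ha (x 5)).congr' ?_
  -- for `r > 0` the integral IS the ratio: slab balls, push-forward, Tonelli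
  filter_upwards [self_mem_nhdsWithin] with r hr
  rw [lintegral_mul_const _ (measurable_measure_prodMk_right (measurableSet_slab _ _ r)),
    ← Measure.prod_apply_symm (measurableSet_slab _ _ r), ← hprod,
    Measure.map_apply hπ (measurableSet_slab _ _ r), ← ball_eq_preimage_slab x hr,
    div_eq_mul_inv]

end Summit.SmoothPoincare4.SmoothPoincare4.Cruxes.CylinderRungTwo.KillingFlux

end
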